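import Summits.ResolutionOfSingularities.ResolutionOfSingularities.Theorems.EquisingularLiftEquisingularLiftNatSpecimenQuarticForms
import HarnessLib

/-!
# [OURS · L1 W4.5(b)] T-ISO-1 algebra layer, V: the point step at the OTHER singular point (`x₃ = 1`, `fSing′ = y₀² + y₁⁴ + y₂⁴`)

Helper for the research stub `stub_elnat_tcDeltaPointResolution` (T-ISO-0⁺) of the crux `EquisingularLiftNat`
(stmt-ResolutionOfSingularities-20038; route `EquisingularLift`, chain w45b; res-L1-w45b-lead-2 CUT 08:41:07Z
«SPECIMEN-Q DOWNSTAIRS» for res-D-pv-034: «two singular points [1:0:0:0], [0:0:0:1]; at each: (TC) …»).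
NOT a statement of any manuscript; AI-written kernel lemma of the cell `res-hironaka` (weaker than expert review).

`…NatSpecimenQuarticPointStep` (p511135) treats the chart polynomial `f = y₂² + y₀⁴ + y₁⁴` (`= fSing = F(x₀ := 1)`, the
point `[1:0:0:0]`). The chart `x₃ = 1` of the point `[0:0:0:1]` has `F(x₃ := 1) = fSing′ = y₀² + y₁⁴ + y₂⁴ = fSing` with
`y₀ ↔ y₂` (`fSing'_eq_rename`, p514698). This file TRANSPORTS the point step along the coordinate swap
`σ = (0 2)` (`renameEquiv`, `Ideal.quotientEquiv`, `blowupAlgebra.congrEquiv`), so that the second (TC) step is available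
BY NAME in the same shape:

* `rename_swap_f`, `map_originIdeal_rename_swap` — bookkeeping (`σ(f) = f′`, `σ(𝔪₀) = 𝔪₀`);
* **`isRegularRing_pointChart₀'`** — the `y₀`-chart (the «`z`-chart» of `fSing′`) of the point step of `V(fSing′)` is REGULAR;
* **`nonempty_pointChart₂'_equiv`**, **`nonempty_pointChart₁'_equiv`** — the `y₂`- and `y₁`-charts are
  `≅ k[y₀,y₁,y₂]/(g)`, `g = y₂² + y₁²(1 + y₀⁴)` = the SAME line-step input as at the first point (so
  `…NatSpecimenQuarticLineStep` / `…TangentLine` apply verbatim at both points).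

References: folklore (transport of structure); the cited tree files.
-/

set_option linter.dupNamespace false -- mandated namespace `Summit.<Summit>.<Problem>` of this single-conjunct summit

noncomputable section

open MvPolynomial
open Literature.AlgebraicGeometry.Resolution
open Summit.ResolutionOfSingularities.ResolutionOfSingularities.Cruxes.EquisingularLiftNat.Sections

namespace Summit.ResolutionOfSingularities.ResolutionOfSingularities.Theorems.EquisingularLift.SpecimenQuartic

variable (k : Type) [Field k]

/-- The swap `y₀ ↔ y₂` takes `f = y₂² + y₀⁴ + y₁⁴` to `f′ = y₀² + y₁⁴ + y₂⁴`. [folklore] -/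
theorem rename_swap_f :
    rename (Equiv.swap (0 : Fin 3) 2) (X 2 ^ 2 + X 0 ^ 4 + X 1 ^ 4 : MvPolynomial (Fin 3) k) =
      X 0 ^ 2 + X 1 ^ 4 + X 2 ^ 4 := by
  rw [show (X 0 ^ 2 + X 1 ^ 4 + X 2 ^ 4 : MvPolynomial (Fin 3) k) = fSing' k from rfl, fSing'_eq_rename]
  rfl

/-- The swap preserves the origin ideal `𝔪₀ = (y₀, y₁, y₂)`. [folklore] -/
theorem map_originIdeal_rename_swap :
    (PointBlowup.originIdeal 2 k).map ((renameEquiv k (Equiv.swap (0 : Fin 3) 2)).toRingEquiv : _ →+* _) =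
      PointBlowup.originIdeal 2 k := by
  rw [PointBlowup.originIdeal, Ideal.map_span, ← Set.range_comp]
  have hr : Set.range ((((renameEquiv k (Equiv.swap (0 : Fin 3) 2)).toRingEquiv : _ →+* _)) ∘
      (X : Fin 3 → MvPolynomial (Fin 3) k)) = Set.range (X : Fin 3 → MvPolynomial (Fin 3) k) := by
    ext q
    constructor
    · rintro ⟨i, rfl⟩
      exact ⟨Equiv.swap (0 : Fin 3) 2 i, by simp [rename_X]⟩
    · rintro ⟨i, rfl⟩
      refine ⟨Equiv.swap (0 : Fin 3) 2 i, ?_⟩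
      simp [rename_X, Equiv.swap_apply_self]
  rw [hr]

/-- The induced isomorphism `ē : A/(f′) ≃+* A/(f)` of the swap (an involution). [folklore] -/
theorem exists_quotientEquiv_swap :
    ∃ ē : (MvPolynomial (Fin 3) k ⧸ Ideal.span {(X 0 ^ 2 + X 1 ^ 4 + X 2 ^ 4 : MvPolynomial (Fin 3) k)}) ≃+*
        (MvPolynomial (Fin 3) k ⧸ Ideal.span {(X 2 ^ 2 + X 0 ^ 4 + X 1 ^ 4 : MvPolynomial (Fin 3) k)}),
      (∀ x, ē (Ideal.Quotient.mk _ x) = Ideal.Quotient.mk _ (rename (Equiv.swap (0 : Fin 3) 2) x)) := by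
  have hf : rename (Equiv.swap (0 : Fin 3) 2) (X 0 ^ 2 + X 1 ^ 4 + X 2 ^ 4 : MvPolynomial (Fin 3) k) =
      X 2 ^ 2 + X 0 ^ 4 + X 1 ^ 4 := by
    simp only [map_add, map_pow, rename_X, Equiv.swap_apply_left, Equiv.swap_apply_right,
      Equiv.swap_apply_of_ne_of_ne (show (1 : Fin 3) ≠ 0 by decide) (show (1 : Fin 3) ≠ 2 by decide)]
    ring
  refine ⟨Ideal.quotientEquiv _ _ (renameEquiv k (Equiv.swap (0 : Fin 3) 2)).toRingEquiv ?_, fun x => rfl⟩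
  rw [Ideal.map_span, Set.image_singleton]
  exact congrArg (fun q => Ideal.span {q}) hf.symm

/-- `σ ∘ σ = id` for the swap. [folklore] -/
theorem swap_comp_swap : (⇑(Equiv.swap (0 : Fin 3) 2) ∘ ⇑(Equiv.swap (0 : Fin 3) 2)) = id :=
  funext fun i => Equiv.swap_apply_self _ _ i

/-- Transport of the exceptional ideal `𝔪₀·(A/(f′))` along `ē`: it goes to `𝔪₀·(A/(f))`. [folklore] -/
theorem map_originIdeal_quot_swap
    (ē : (MvPolynomial (Fin 3) k ⧸ Ideal.span {(X 0 ^ 2 + X 1 ^ 4 + X 2 ^ 4 : MvPolynomial (Fin 3) k)}) ≃+*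
        (MvPolynomial (Fin 3) k ⧸ Ideal.span {(X 2 ^ 2 + X 0 ^ 4 + X 1 ^ 4 : MvPolynomial (Fin 3) k)}))
    (hē : ∀ x, ē (Ideal.Quotient.mk _ x) = Ideal.Quotient.mk _ (rename (Equiv.swap (0 : Fin 3) 2) x)) :
    ((PointBlowup.originIdeal 2 k).map
      (Ideal.Quotient.mk (Ideal.span {(X 0 ^ 2 + X 1 ^ 4 + X 2 ^ 4 : MvPolynomial (Fin 3) k)}))).map ē.toRingHom =
      (PointBlowup.originIdeal 2 k).map
        (Ideal.Quotient.mk (Ideal.span {(X 2 ^ 2 + X 0 ^ 4 + X 1 ^ 4 : MvPolynomial (Fin 3) k)})) := by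
  rw [Ideal.map_map]
  have hcomp : ē.toRingHom.comp (Ideal.Quotient.mk (Ideal.span {(X 0 ^ 2 + X 1 ^ 4 + X 2 ^ 4 : MvPolynomial (Fin 3) k)})) =
      (Ideal.Quotient.mk (Ideal.span {(X 2 ^ 2 + X 0 ^ 4 + X 1 ^ 4 : MvPolynomial (Fin 3) k)})).comp
        ((renameEquiv k (Equiv.swap (0 : Fin 3) 2)).toRingEquiv : _ →+* _) :=
    RingHom.ext fun x => hē x
  rw [hcomp, ← Ideal.map_map, map_originIdeal_rename_swap]

/-- Transport of `𝔪₀·(A/(f))` along `ē⁻¹`: it goes to `𝔪₀·(A/(f′))`. [folklore] -/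
theorem map_originIdeal_quot_swap_symm
    (ē : (MvPolynomial (Fin 3) k ⧸ Ideal.span {(X 0 ^ 2 + X 1 ^ 4 + X 2 ^ 4 : MvPolynomial (Fin 3) k)}) ≃+*
        (MvPolynomial (Fin 3) k ⧸ Ideal.span {(X 2 ^ 2 + X 0 ^ 4 + X 1 ^ 4 : MvPolynomial (Fin 3) k)}))
    (hē : ∀ x, ē (Ideal.Quotient.mk _ x) = Ideal.Quotient.mk _ (rename (Equiv.swap (0 : Fin 3) 2) x)) :
    ((PointBlowup.originIdeal 2 k).map
      (Ideal.Quotient.mk (Ideal.span {(X 2 ^ 2 + X 0 ^ 4 + X 1 ^ 4 : MvPolynomial (Fin 3) k)}))).map ē.symm.toRingHom =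
      (PointBlowup.originIdeal 2 k).map
        (Ideal.Quotient.mk (Ideal.span {(X 0 ^ 2 + X 1 ^ 4 + X 2 ^ 4 : MvPolynomial (Fin 3) k)})) := by
  rw [Ideal.map_map]
  have hpt : ∀ x, ē.symm (Ideal.Quotient.mk _ x) =
      Ideal.Quotient.mk (Ideal.span {(X 0 ^ 2 + X 1 ^ 4 + X 2 ^ 4 : MvPolynomial (Fin 3) k)})
        (rename (Equiv.swap (0 : Fin 3) 2) x) := by
    intro x
    apply ē.injective
    rw [RingEquiv.apply_symm_apply, hē, rename_rename, swap_comp_swap, rename_id]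
    rfl
  have hcomp : ē.symm.toRingHom.comp (Ideal.Quotient.mk (Ideal.span {(X 2 ^ 2 + X 0 ^ 4 + X 1 ^ 4 : MvPolynomial (Fin 3) k)})) =
      (Ideal.Quotient.mk (Ideal.span {(X 0 ^ 2 + X 1 ^ 4 + X 2 ^ 4 : MvPolynomial (Fin 3) k)})).comp
        ((renameEquiv k (Equiv.swap (0 : Fin 3) 2)).toRingEquiv : _ →+* _) :=
    RingHom.ext fun x => hpt x
  rw [hcomp, ← Ideal.map_map, map_originIdeal_rename_swap]

/-- **The `y₀`-chart of the point step of `V(y₀² + y₁⁴ + y₂⁴)` is regular** (transport of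
`isRegularRing_pointChart₂` along `y₀ ↔ y₂`; `char k ≠ 2`). [OURS · T-ISO-1 algebra] -/
theorem isRegularRing_pointChart₀' (h2 : IsUnit (2 : k)) :
    IsRegularRing (blowupAlgebra ((PointBlowup.originIdeal 2 k).map
        (Ideal.Quotient.mk (Ideal.span {(X 0 ^ 2 + X 1 ^ 4 + X 2 ^ 4 : MvPolynomial (Fin 3) k)})))
      (Ideal.Quotient.mk (Ideal.span {(X 0 ^ 2 + X 1 ^ 4 + X 2 ^ 4 : MvPolynomial (Fin 3) k)}) (X 0))) := by
  obtain ⟨ē, hē⟩ := exists_quotientEquiv_swap k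
  refine WhitneyCubic.isRegularRing_blowupAlgebra_of_ringEquiv ē _ _ ?_
  have hb : ē (Ideal.Quotient.mk _ (X 0)) = Ideal.Quotient.mk _ (X 2) := by
    rw [hē, rename_X, Equiv.swap_apply_left]
  rw [map_originIdeal_quot_swap k ē hē]
  rw [show ē (Ideal.Quotient.mk _ (X 0)) = Ideal.Quotient.mk _ (X 2) from hb]
  exact isRegularRing_pointChart₂ k h2

/-- **The `y₂`-chart of the point step of `V(y₀² + y₁⁴ + y₂⁴)` is `≅ k[y]/(g)`**, `g = y₂² + y₁²(1 + y₀⁴)` (transport of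
`nonempty_pointChart₀_equiv` along `y₀ ↔ y₂`). [OURS · T-ISO-1 algebra] -/
theorem nonempty_pointChart₂'_equiv :
    Nonempty ((MvPolynomial (Fin 3) k ⧸ Ideal.span {(X 2 ^ 2 + X 1 ^ 2 * (1 + X 0 ^ 4) : MvPolynomial (Fin 3) k)}) ≃+*
      blowupAlgebra ((PointBlowup.originIdeal 2 k).map
        (Ideal.Quotient.mk (Ideal.span {(X 0 ^ 2 + X 1 ^ 4 + X 2 ^ 4 : MvPolynomial (Fin 3) k)})))
      (Ideal.Quotient.mk (Ideal.span {(X 0 ^ 2 + X 1 ^ 4 + X 2 ^ 4 : MvPolynomial (Fin 3) k)}) (X 2))) := by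
  obtain ⟨ē, hē⟩ := exists_quotientEquiv_swap k
  obtain ⟨θ⟩ := nonempty_pointChart₀_equiv k
  have hb : ē.symm (Ideal.Quotient.mk _ (X 0)) =
      Ideal.Quotient.mk (Ideal.span {(X 0 ^ 2 + X 1 ^ 4 + X 2 ^ 4 : MvPolynomial (Fin 3) k)}) (X 2) := by
    apply ē.injective
    rw [RingEquiv.apply_symm_apply, hē, rename_X, Equiv.swap_apply_right]
  have e2 := blowupAlgebra.congrEquiv ē.symm
    ((PointBlowup.originIdeal 2 k).map (Ideal.Quotient.mk (Ideal.span {(X 2 ^ 2 + X 0 ^ 4 + X 1 ^ 4 : MvPolynomial (Fin 3) k)})))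
    (Ideal.Quotient.mk _ (X 0))
  rw [map_originIdeal_quot_swap_symm k ē hē, hb] at e2
  exact ⟨θ.trans e2⟩

/-- **The `y₁`-chart of the point step of `V(y₀² + y₁⁴ + y₂⁴)` is `≅ k[y]/(g)`** (transport of `nonempty_pointChart₁_equiv`;
the swap fixes `y₁`). [OURS · T-ISO-1 algebra] -/
theorem nonempty_pointChart₁'_equiv :
    Nonempty ((MvPolynomial (Fin 3) k ⧸ Ideal.span {(X 2 ^ 2 + X 1 ^ 2 * (1 + X 0 ^ 4) : MvPolynomial (Fin 3) k)}) ≃+*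
      blowupAlgebra ((PointBlowup.originIdeal 2 k).map
        (Ideal.Quotient.mk (Ideal.span {(X 0 ^ 2 + X 1 ^ 4 + X 2 ^ 4 : MvPolynomial (Fin 3) k)})))
      (Ideal.Quotient.mk (Ideal.span {(X 0 ^ 2 + X 1 ^ 4 + X 2 ^ 4 : MvPolynomial (Fin 3) k)}) (X 1))) := by
  obtain ⟨ē, hē⟩ := exists_quotientEquiv_swap k
  obtain ⟨θ⟩ := nonempty_pointChart₁_equiv k
  have hb : ē.symm (Ideal.Quotient.mk _ (X 1)) =
      Ideal.Quotient.mk (Ideal.span {(X 0 ^ 2 + X 1 ^ 4 + X 2 ^ 4 : MvPolynomial (Fin 3) k)}) (X 1) := by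
    apply ē.injective
    rw [RingEquiv.apply_symm_apply, hē, rename_X,
      Equiv.swap_apply_of_ne_of_ne (show (1 : Fin 3) ≠ 0 by decide) (show (1 : Fin 3) ≠ 2 by decide)]
  have e2 := blowupAlgebra.congrEquiv ē.symm
    ((PointBlowup.originIdeal 2 k).map (Ideal.Quotient.mk (Ideal.span {(X 2 ^ 2 + X 0 ^ 4 + X 1 ^ 4 : MvPolynomial (Fin 3) k)})))
    (Ideal.Quotient.mk _ (X 1))
  rw [map_originIdeal_quot_swap_symm k ē hē, hb] at e2
  exact ⟨θ.trans e2⟩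

end Summit.ResolutionOfSingularities.ResolutionOfSingularities.Theorems.EquisingularLift.SpecimenQuartic

end
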